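import Summits.CriticalPhenomena.Ising3D.IsingColumnFaceL11CensusKacx

/-!
# The rational-table census of §7.3 as kernel facts, III: covering radii — how wide a sub-interval of
the certified segment must be before it is FORCED to contain a tabulated «exact value»
(cell `pub-ising3x`, seat recog-1; paper §1.6 / §7.3; companion of `IsingColumnFaceL11Census{,Kacx}.lean`)

HONEST FRAMING: lottery ticket; floor = tightest certified 3D Ising CFT bounds; no exact-solution
claim without a proof. Island framing: certified exclusion region at stated derivative order and
assumptions; not a determination of the 3D Ising critical exponents beyond that.

Paper §1.6 / §7.3 say that membership of a catalogue value in a certified interval «carries no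
evidential weight in either direction» because «at 10⁻² widths a catalogue of this kind always has
thousands of members inside». Parts I–II made the member lists and counts of the three RATIONAL
families of the frozen catalogue FAMILIES-v1 on the certified segment `[81/64, 2855/2048]` of `Δε`
kernel facts (`rat_mem_segment_iff` 164, `kac_mem_segment_iff` 228, `kacx_mem_segment_iff` 509). This
module turns the word «always» into a kernel ∀-statement over EVERY sub-interval, with the sharp
threshold per family (pure arithmetic on the landed lists; no certificate, datum or σ–ε axiom occurs):
* `gapsLE g x L hi` — a one-pass Boolean check that, walking from `x` through the list `L` to `hi`, no
  step exceeds `g`; `gapsLE_sound` — then every real `a` with `x < a`, `a + g ≤ hi` has an entry of `L` in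
  `[a, a + g]` (induction on `L`);
* **`rat_meets_subinterval`** — every closed sub-interval of `[81/64, 2855/2048]` of length `≥ 1/186`
  (`= 0.00537…`) contains a rational of denominator `≤ 64`; **`rat_gap_attained`** — sharp: `4/3` and
  `83/62` are such rationals, `83/62 − 4/3 = 1/186`, and none lies strictly between them;
* **`kac_meets_subinterval`** / **`kac_gap_attained`** — the same for the frozen Kac table
  `kacFamily 24 8` with threshold `7/3040` (`= 0.00230…`), attained by the open gap `(43/32, 1023/760)`;
* **`kacx_meets_subinterval`** / **`kacx_gap_attained`** — the same for the extended tables `kacxFamily`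
  with threshold `1/720` (`= 0.00138…`), attained by `(111/80, 25/18)`;
* **`tables_meet_subinterval`** / **`tables_gap_attained`** — the union of the three tables (728 distinct
  rationals in the segment — `tables_segment_ncard`, counted through three disjoint denominator-split
  pieces): threshold `2/1443` (`= 0.001386…`), attained by `(4/3, 642/481)` — the catalogue is sparsest
  next to its simplest member `4/3` (a Farey-type repulsion), i.e. exactly where a coincidence would be
  least ambiguous; the covering is witnessed by an explicit 102-entry chain `tablesChain` of listed
  members with steps `≤ 2/1443`;
* **`tables_meet_every_centi_interval`** — the reading for §1.6: every sub-interval of the certified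
  segment of length `≥ 1/100` contains a rational of denominator `≤ 64` AND a Kac-table value AND an
  extended-table value. So no certified `Δε`-statement at the `10⁻²` level, wherever it sits in the
  segment, can fail to «contain exact values» of all three rational families; conversely a certified
  interval free of all of them must be shorter than `2/1443`, and free of `RAT(64)` shorter than `1/186`.
The thresholds were first computed by an exact-fraction script (recog-1 gen 49) from the landed lists and
are CERTIFIED here by the kernel (`decide +kernel`; the whole module elaborates in ≈ 15 s on the farm, the
728-count through the pieces `kacOnly` / `kacxOnly` in a few seconds). The real-valued
families `ALG` / `LIN` / `TRG` (10⁴ members on the segment, §7.3) are far denser still and stay census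
numbers. Value: the arithmetic behind one honesty sentence made exact; no P(M·) relevance; nothing is
recognised. lottery ticket; floor = tightest certified 3D Ising CFT bounds; no exact-solution claim without a proof.
-/

namespace Summit.CriticalPhenomena.Ising3D
namespace ColumnFaceL11
open Set Literature.MathematicalPhysics.QuantumFieldTheory.ConformalBootstrap3D

/-! ### A one-pass gap checker and its soundness -/

/-- `gapsLE g x L hi`: walking from `x` through the entries of `L` in order and finally to `hi`, every
step is at most `g`. [folklore] -/
def gapsLE (g : ℚ) : ℚ → List ℚ → ℚ → Bool
  | x, [], hi => decide (hi - x ≤ g)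
  | x, y :: ys, hi => decide (y - x ≤ g) && gapsLE g y ys hi

/-- **Soundness of the gap checker.** If `gapsLE g x L hi = true` then every real `a` with `x < a` and
`a + g ≤ hi` has an entry of `L` in the closed interval `[a, a + g]` (induction on `L`: the first entry
`y` serves if `a ≤ y`, since `y ≤ x + g < a + g`; otherwise recurse from `y`). [folklore] -/
theorem gapsLE_sound {g hi : ℚ} :
    ∀ {x : ℚ} {L : List ℚ}, gapsLE g x L hi = true →
      ∀ a : ℝ, (x : ℝ) < a → a + g ≤ hi → ∃ r ∈ L, a ≤ (r : ℝ) ∧ (r : ℝ) ≤ a + g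
  | x, [], h, a, hxa, hah => by
    simp only [gapsLE, decide_eq_true_eq] at h
    have h' : (hi : ℝ) - x ≤ g := by exact_mod_cast h
    exact absurd hah (by linarith)
  | x, y :: ys, h, a, hxa, hah => by
    simp only [gapsLE, Bool.and_eq_true, decide_eq_true_eq] at h
    have h' : (y : ℝ) - x ≤ g := by exact_mod_cast h.1
    by_cases hay : a ≤ (y : ℝ)
    · exact ⟨y, List.mem_cons_self, hay, by linarith⟩
    · obtain ⟨r, hr, har, hrg⟩ := gapsLE_sound h.2 a (lt_of_not_ge hay) hah
      exact ⟨r, List.mem_cons_of_mem y hr, har, hrg⟩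

/-! ### Family `RAT` (denominator `≤ 64`): threshold `1/186` -/

/-- Gap check of the landed `RAT(64)` list on the segment: starting just below `81/64` (which is itself
listed), consecutive listed rationals — and finally the face `2855/2048` — are never more than `1/186`
apart. [folklore] -/
theorem rat_gapsLE : gapsLE (1 / 186) (81 / 64 - 1 / 10 ^ 6) ratSegment (2855 / 2048) = true := by
  decide +kernel

/-- **Covering radius of `RAT(64)` on the certified segment.** Every closed sub-interval `[a, b]` of
`[81/64, 2855/2048]` of length at least `1/186 = 0.00537…` contains a rational of denominator `≤ 64`.
[folklore] -/
theorem rat_meets_subinterval (a b : ℝ) (ha : (81 / 64 : ℝ) ≤ a) (hb : b ≤ 2855 / 2048)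
    (hab : (1 / 186 : ℝ) ≤ b - a) : ∃ r : ℚ, r.den ≤ 64 ∧ a ≤ (r : ℝ) ∧ (r : ℝ) ≤ b := by
  obtain ⟨r, hr, har, hrb⟩ :=
    gapsLE_sound rat_gapsLE a (by push_cast; linarith) (by push_cast; linarith)
  exact ⟨r, ((rat_mem_segment_iff r).mpr hr).1, har, by push_cast at hrb; linarith⟩

/-- No listed `RAT(64)` value lies strictly between `4/3` and `83/62`. [folklore] -/
theorem ratSegment_noGap :
    (ratSegment.all fun r => !decide ((4 / 3 : ℚ) < r ∧ r < 83 / 62)) = true := by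
  decide +kernel

/-- **The threshold `1/186` is attained.** `4/3` and `83/62` are rationals of denominator `≤ 64` in the
segment at distance exactly `1/186` (Farey neighbours: `83·3 − 62·4 = 1`), and no rational of
denominator `≤ 64` lies strictly between them — an open sub-interval of length `1/186` free of `RAT(64)`.
[folklore] -/
theorem rat_gap_attained :
    (83 / 62 : ℚ) - 4 / 3 = 1 / 186 ∧ (4 / 3 : ℚ).den ≤ 64 ∧ (83 / 62 : ℚ).den ≤ 64 ∧
      ∀ r : ℚ, r.den ≤ 64 → ¬((4 / 3 : ℚ) < r ∧ r < 83 / 62) := by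
  refine ⟨by norm_num, by decide +kernel, by decide +kernel, fun r hd hr => ?_⟩
  have hmem : r ∈ ratSegment :=
    (rat_mem_segment_iff r).mp ⟨hd, by linarith [hr.1], by linarith [hr.2]⟩
  have := List.all_eq_true.mp ratSegment_noGap r hmem
  simp only [Bool.not_eq_true', decide_eq_false_iff_not] at this
  exact this hr

/-! ### Family `KAC` (`kacFamily 24 8`): threshold `7/3040` -/

/-- Gap check of the landed `KAC` list on the segment (first listed value `19/15 = 81/64 + 1/960`).
[folklore] -/
theorem kac_gapsLE : gapsLE (7 / 3040) (81 / 64 - 1 / 10 ^ 6) kacSegment (2855 / 2048) = true := by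
  decide +kernel

/-- **Covering radius of `KAC` on the certified segment.** Every closed sub-interval `[a, b]` of
`[81/64, 2855/2048]` of length at least `7/3040 = 0.00230…` contains a value of the frozen Kac table
(`2h_{r,s}(p,p′) + n`, `p′ ≤ 24`, `n ≤ 8`). [folklore] -/
theorem kac_meets_subinterval (a b : ℝ) (ha : (81 / 64 : ℝ) ≤ a) (hb : b ≤ 2855 / 2048)
    (hab : (7 / 3040 : ℝ) ≤ b - a) :
    ∃ v : ℚ, v ∈ kacFamily 24 8 ∧ a ≤ (v : ℝ) ∧ (v : ℝ) ≤ b := by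
  obtain ⟨v, hv, hav, hvb⟩ :=
    gapsLE_sound kac_gapsLE a (by push_cast; linarith) (by push_cast; linarith)
  exact ⟨v, ((kac_mem_segment_iff v).mpr hv).1, hav, by push_cast at hvb; linarith⟩

/-- No listed `KAC` value lies strictly between `43/32` and `1023/760`. [folklore] -/
theorem kacSegment_noGap :
    (kacSegment.all fun v => !decide ((43 / 32 : ℚ) < v ∧ v < 1023 / 760)) = true := by
  decide +kernel

/-- **The threshold `7/3040` is attained.** `43/32` and `1023/760` are Kac-table values in the segment
(listed, hence members by `kac_mem_segment_iff`) at distance exactly `7/3040`, and no value of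
`kacFamily 24 8` lies strictly between them. [folklore] -/
theorem kac_gap_attained :
    (1023 / 760 : ℚ) - 43 / 32 = 7 / 3040 ∧ (43 / 32 : ℚ) ∈ kacFamily 24 8 ∧
      (1023 / 760 : ℚ) ∈ kacFamily 24 8 ∧
      ∀ v : ℚ, v ∈ kacFamily 24 8 → ¬((43 / 32 : ℚ) < v ∧ v < 1023 / 760) := by
  refine ⟨by norm_num, ((kac_mem_segment_iff _).mpr (by decide +kernel)).1,
    ((kac_mem_segment_iff _).mpr (by decide +kernel)).1, fun v hv h => ?_⟩
  have hmem : v ∈ kacSegment :=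
    (kac_mem_segment_iff v).mp ⟨hv, by linarith [h.1], by linarith [h.2]⟩
  have := List.all_eq_true.mp kacSegment_noGap v hmem
  simp only [Bool.not_eq_true', decide_eq_false_iff_not] at this
  exact this h

/-! ### Family `KACX` (`kacxFamily`): threshold `1/720` -/

/-- Gap check of the landed `KACX` list on the segment (`81/64` is itself listed). [folklore] -/
theorem kacx_gapsLE : gapsLE (1 / 720) (81 / 64 - 1 / 10 ^ 6) kacxSegment (2855 / 2048) = true := by
  decide +kernel

/-- **Covering radius of `KACX` on the certified segment.** Every closed sub-interval `[a, b]` of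
`[81/64, 2855/2048]` of length at least `1/720 = 0.00138…` contains a value of the frozen extended tables
(`N = 1` `p′ ≤ 24`, `W₃` `p′ ≤ 16`, `SU(2)_k` / `ℤ_k` with `k + 2 ≤ 40`; weights `h`, `2h`). [folklore] -/
theorem kacx_meets_subinterval (a b : ℝ) (ha : (81 / 64 : ℝ) ≤ a) (hb : b ≤ 2855 / 2048)
    (hab : (1 / 720 : ℝ) ≤ b - a) :
    ∃ v : ℚ, v ∈ kacxFamily ∧ a ≤ (v : ℝ) ∧ (v : ℝ) ≤ b := by
  obtain ⟨v, hv, hav, hvb⟩ :=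
    gapsLE_sound kacx_gapsLE a (by push_cast; linarith) (by push_cast; linarith)
  exact ⟨v, ((kacx_mem_segment_iff v).mpr hv).1, hav, by push_cast at hvb; linarith⟩

/-- No listed `KACX` value lies strictly between `111/80` and `25/18`. [folklore] -/
theorem kacxSegment_noGap :
    (kacxSegment.all fun v => !decide ((111 / 80 : ℚ) < v ∧ v < 25 / 18)) = true := by
  decide +kernel

/-- **The threshold `1/720` is attained.** `111/80` and `25/18` are extended-table values in the segment
at distance exactly `1/720`, and no value of `kacxFamily` lies strictly between them. [folklore] -/
theorem kacx_gap_attained :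
    (25 / 18 : ℚ) - 111 / 80 = 1 / 720 ∧ (111 / 80 : ℚ) ∈ kacxFamily ∧ (25 / 18 : ℚ) ∈ kacxFamily ∧
      ∀ v : ℚ, v ∈ kacxFamily → ¬((111 / 80 : ℚ) < v ∧ v < 25 / 18) := by
  refine ⟨by norm_num, ((kacx_mem_segment_iff _).mpr (by decide +kernel)).1,
    ((kacx_mem_segment_iff _).mpr (by decide +kernel)).1, fun v hv h => ?_⟩
  have hmem : v ∈ kacxSegment :=
    (kacx_mem_segment_iff v).mp ⟨hv, by linarith [h.1], by linarith [h.2]⟩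
  have := List.all_eq_true.mp kacxSegment_noGap v hmem
  simp only [Bool.not_eq_true', decide_eq_false_iff_not] at this
  exact this h

/-! ### The three tables together: threshold `2/1443`, attained next to `4/3` -/

/-- A 102-entry chain of listed table values (32 of them in `ratSegment`, 39 in `kacSegment`, 68 in
`kacxSegment`, counting overlaps) walking the segment in steps of at most `2/1443`, chosen greedily by
the generating script; every entry is certified listed below. [folklore] -/
def tablesChain : List ℚ :=
  ([(280, 221), (52, 41), (146, 115), (61, 48), (463, 364), (508, 399), (65, 51), (37, 29),
     (1019, 798), (147, 115), (1295, 1012), (1363, 1064), (50, 39), (77, 60), (325, 253), (9, 7),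
     (937, 728), (67, 52), (227, 176), (1229, 952), (84, 65), (2815, 2176), (417, 322), (35, 27),
     (109, 84), (100, 77), (13, 10), (229, 176), (56, 43), (73, 56), (458, 351), (273, 209),
     (795, 608), (572, 437), (891, 680), (80, 61), (256, 195), (205, 156), (1431, 1088), (391, 297),
     (112, 85), (91, 69), (961, 728), (37, 28), (250, 189), (143, 108), (167, 126), (65, 49),
     (81, 61), (101, 76), (383, 288), (527, 396), (766, 575), (4, 3), (642, 481), (1046, 783),
     (1091, 816), (265, 198), (280, 209), (1223, 912), (247, 184), (43, 32), (577, 429), (35, 26),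
     (128, 95), (263, 195), (27, 20), (50, 37), (211, 156), (88, 65), (42, 31), (1756, 1295),
     (19, 14), (72, 53), (359, 264), (49, 36), (440, 323), (2509, 1840), (116, 85), (153, 112),
     (361, 264), (219, 160), (374, 273), (181, 132), (70, 51), (136, 99), (11, 8), (128, 93),
     (197, 143), (6597, 4784), (69, 50), (540, 391), (47, 34), (1129, 816), (421, 304), (262, 189),
     (111, 80), (229, 165), (25, 18), (57, 41), (263, 189), (39, 28)] : List (ℕ × ℕ)).map
    fun e => (e.1 : ℚ) / e.2

/-- Every entry of `tablesChain` is in one of the three landed segment lists, and the chain has 102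
entries. [folklore] -/
theorem tablesChain_listed :
    (tablesChain.all fun r =>
        decide (r ∈ ratSegment) || decide (r ∈ kacSegment) || decide (r ∈ kacxSegment)) = true ∧
      tablesChain.length = 102 := by
  decide +kernel

/-- Gap check of the chain on the segment: steps `≤ 2/1443` from just below `81/64` to the face.
[folklore] -/
theorem tables_gapsLE :
    gapsLE (2 / 1443) (81 / 64 - 1 / 10 ^ 6) tablesChain (2855 / 2048) = true := by
  decide +kernel

/-- **Covering radius of the three rational tables together.** Every closed sub-interval `[a, b]` of
the certified segment `[81/64, 2855/2048]` of length at least `2/1443 = 0.001386…` contains a rational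
of denominator `≤ 64`, a value of the frozen Kac table, or a value of the frozen extended tables.
[folklore] -/
theorem tables_meet_subinterval (a b : ℝ) (ha : (81 / 64 : ℝ) ≤ a) (hb : b ≤ 2855 / 2048)
    (hab : (2 / 1443 : ℝ) ≤ b - a) :
    ∃ v : ℚ, (v.den ≤ 64 ∨ v ∈ kacFamily 24 8 ∨ v ∈ kacxFamily) ∧ a ≤ (v : ℝ) ∧ (v : ℝ) ≤ b := by
  obtain ⟨v, hv, hav, hvb⟩ :=
    gapsLE_sound tables_gapsLE a (by push_cast; linarith) (by push_cast; linarith)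
  refine ⟨v, ?_, hav, by push_cast at hvb; linarith⟩
  have h3 := List.all_eq_true.mp tablesChain_listed.1 v hv
  simp only [Bool.or_eq_true, decide_eq_true_eq] at h3
  rcases h3 with (h | h) | h
  · exact Or.inl ((rat_mem_segment_iff v).mpr h).1
  · exact Or.inr (Or.inl ((kac_mem_segment_iff v).mpr h).1)
  · exact Or.inr (Or.inr ((kacx_mem_segment_iff v).mpr h).1)

/-- The listed `KAC` values of denominator `> 64`, i.e. (by `rat_mem_segment_iff`) the listed Kac values
that are not `RAT(64)` members: 169 of the 228. [folklore] -/
def kacOnly : List ℚ :=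
  kacSegment.filter fun v => decide (64 < v.den)

/-- The listed `KACX` values of denominator `> 64` that are not listed `KAC` values (compared with every
`KAC` entry denominator-first, so that almost all comparisons are of small naturals): 395 of the 509.
[folklore] -/
def kacxOnly : List ℚ :=
  kacxSegment.filter fun v => decide (64 < v.den ∧ ∀ w ∈ kacSegment, w.den ≠ v.den ∨ w.num ≠ v.num)

/-- Membership in `kacOnly`. [folklore] -/
theorem mem_kacOnly {v : ℚ} : v ∈ kacOnly ↔ v ∈ kacSegment ∧ 64 < v.den := by
  rw [kacOnly, List.mem_filter, decide_eq_true_eq]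

/-- Membership in `kacxOnly`: listed `KACX`, denominator `> 64`, not a listed `KAC` value (two rationals
with equal numerators and denominators are equal, `Rat.ext`). [folklore] -/
theorem mem_kacxOnly {v : ℚ} : v ∈ kacxOnly ↔ v ∈ kacxSegment ∧ 64 < v.den ∧ v ∉ kacSegment := by
  rw [kacxOnly, List.mem_filter, decide_eq_true_eq]
  constructor
  · rintro ⟨hx, hd, hall⟩
    exact ⟨hx, hd, fun hk => by rcases hall v hk with h | h <;> exact h rfl⟩
  · rintro ⟨hx, hd, hk⟩
    refine ⟨hx, hd, fun w hw => ?_⟩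
    by_cases hde : w.den = v.den
    · exact Or.inr fun hnu => hk (by rw [Rat.ext hnu hde] at hw; exact hw)
    · exact Or.inl hde

/-- The three pieces `ratSegment`, `kacOnly`, `kacxOnly` are duplicate-free and pairwise disjoint.
[folklore] -/
theorem tablesPieces_nodup : (ratSegment ++ kacOnly ++ kacxOnly).Nodup := by
  have d1 : ∀ v, v ∈ ratSegment → v ∈ kacOnly → False := fun v hR hK =>
    absurd ((rat_mem_segment_iff v).mpr hR).1 (not_le.mpr (mem_kacOnly.mp hK).2)
  have d2 : ∀ v, v ∈ ratSegment ++ kacOnly → v ∈ kacxOnly → False := fun v hRK hX => by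
    obtain ⟨_, hd, hk⟩ := mem_kacxOnly.mp hX
    rcases List.mem_append.mp hRK with hR | hK
    · exact absurd ((rat_mem_segment_iff v).mpr hR).1 (not_le.mpr hd)
    · exact hk (mem_kacOnly.mp hK).1
  exact List.nodup_append'.2 ⟨List.nodup_append'.2 ⟨nodup_of_isChain_lt ratSegment_spec.2.1,
    (nodup_of_isChain_lt kacSegment_spec.2.1).filter _, d1⟩,
    (nodup_of_isChain_lt kacxSegment_spec.2.1).filter _, d2⟩

/-- A rational in the segment belongs to `RAT(64) ∪ KAC ∪ KACX` iff it is an entry of one of the three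
disjoint pieces (the three completeness theorems, split by denominator and table). [folklore] -/
theorem mem_tables_iff (v : ℚ) :
    ((v.den ≤ 64 ∨ v ∈ kacFamily 24 8 ∨ v ∈ kacxFamily) ∧ (81 / 64 : ℚ) ≤ v ∧ v ≤ 2855 / 2048) ↔
      v ∈ ratSegment ++ kacOnly ++ kacxOnly := by
  rw [List.mem_append, List.mem_append, mem_kacOnly, mem_kacxOnly]
  constructor
  · rintro ⟨hf, ha, hb⟩
    by_cases h64 : v.den ≤ 64
    · exact Or.inl (Or.inl ((rat_mem_segment_iff v).mp ⟨h64, ha, hb⟩))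
    · by_cases hk : v ∈ kacSegment
      · exact Or.inl (Or.inr ⟨hk, not_le.mp h64⟩)
      · rcases hf with hf | hf | hf
        · exact absurd hf h64
        · exact absurd ((kac_mem_segment_iff v).mp ⟨hf, ha, hb⟩) hk
        · exact Or.inr ⟨(kacx_mem_segment_iff v).mp ⟨hf, ha, hb⟩, not_le.mp h64, hk⟩
  · rintro ((hR | ⟨hK, _⟩) | ⟨hX, _, _⟩)
    · obtain ⟨hd, ha, hb⟩ := (rat_mem_segment_iff v).mpr hR
      exact ⟨Or.inl hd, ha, hb⟩
    · obtain ⟨hf, ha, hb⟩ := (kac_mem_segment_iff v).mpr hK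
      exact ⟨Or.inr (Or.inl hf), ha, hb⟩
    · obtain ⟨hf, ha, hb⟩ := (kacx_mem_segment_iff v).mpr hX
      exact ⟨Or.inr (Or.inr hf), ha, hb⟩

/-- The pieces have 164 + 169 + 395 = 728 entries. [folklore] -/
theorem tablesPieces_length : (ratSegment ++ kacOnly ++ kacxOnly).length = 728 := by
  decide +kernel

/-- **728 distinct** tabulated rationals in the certified segment: the members of
`RAT(64) ∪ KAC ∪ KACX` in `[81/64, 2855/2048]` (the three landed lists have 164 + 228 + 509 = 901 entries
and 173 coincidences, e.g. `4/3`, `13/10`, `27/20`). [folklore] -/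
theorem tables_segment_ncard :
    {v : ℚ | (v.den ≤ 64 ∨ v ∈ kacFamily 24 8 ∨ v ∈ kacxFamily) ∧ 81 / 64 ≤ v ∧ v ≤ 2855 / 2048}.ncard
      = 728 :=
  (ncard_eq_length_of_iff tablesPieces_nodup mem_tables_iff).trans tablesPieces_length

/-- No listed value of any of the three tables lies strictly between `4/3` and `642/481`. [folklore] -/
theorem segments_noGap :
    ((ratSegment ++ kacSegment ++ kacxSegment).all
        fun v => !decide ((4 / 3 : ℚ) < v ∧ v < 642 / 481)) = true := by
  decide +kernel

/-- **The threshold `2/1443` is attained, next to `4/3`.** `4/3` (a member of all three tables) and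
`642/481` (an extended-table value) lie in the segment at distance exactly `2/1443`, and no value of any
of the three tables lies strictly between them: the largest hole of the 728-point rational catalogue on
the certified segment is adjacent to its simplest member. [folklore] -/
theorem tables_gap_attained :
    (642 / 481 : ℚ) - 4 / 3 = 2 / 1443 ∧ (4 / 3 : ℚ).den ≤ 64 ∧ (4 / 3 : ℚ) ∈ kacFamily 24 8 ∧
      (4 / 3 : ℚ) ∈ kacxFamily ∧ (642 / 481 : ℚ) ∈ kacxFamily ∧
      ∀ v : ℚ, (v.den ≤ 64 ∨ v ∈ kacFamily 24 8 ∨ v ∈ kacxFamily) →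
        ¬((4 / 3 : ℚ) < v ∧ v < 642 / 481) := by
  refine ⟨by norm_num, by decide +kernel, ((kac_mem_segment_iff _).mpr (by decide +kernel)).1,
    ((kacx_mem_segment_iff _).mpr (by decide +kernel)).1,
    ((kacx_mem_segment_iff _).mpr (by decide +kernel)).1, fun v hv h => ?_⟩
  have ha : (81 / 64 : ℚ) ≤ v := by linarith [h.1]
  have hb : v ≤ (2855 / 2048 : ℚ) := by linarith [h.2]
  have hmem : v ∈ ratSegment ++ kacSegment ++ kacxSegment := by
    rcases hv with hv | hv | hv
    · exact List.mem_append_left _ (List.mem_append_left _ ((rat_mem_segment_iff v).mp ⟨hv, ha, hb⟩))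
    · exact List.mem_append_left _ (List.mem_append_right _ ((kac_mem_segment_iff v).mp ⟨hv, ha, hb⟩))
    · exact List.mem_append_right _ ((kacx_mem_segment_iff v).mp ⟨hv, ha, hb⟩)
  have := List.all_eq_true.mp segments_noGap v hmem
  simp only [Bool.not_eq_true', decide_eq_false_iff_not] at this
  exact this h

/-- The four thresholds in order, against the `10⁻²` scale of §1.6:
`2/1443 < 1/720 < 7/3040 < 1/186 < 1/100`. [folklore] -/
theorem thresholds_ordered :
    (2 / 1443 : ℚ) < 1 / 720 ∧ (1 / 720 : ℚ) < 7 / 3040 ∧ (7 / 3040 : ℚ) < 1 / 186 ∧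
      (1 / 186 : ℚ) < 1 / 100 := by
  norm_num

/-- **The reading for §1.6 / §7.3.** Every closed sub-interval of the certified segment
`[81/64, 2855/2048]` of length at least `1/100` contains a rational of denominator `≤ 64` AND a value
of the frozen Kac table AND a value of the frozen extended tables: at the `10⁻²` level no certified
`Δε`-interval in the segment can avoid «containing exact values» of all three rational families, which
is why such membership is bookkeeping, not evidence. [folklore] -/
theorem tables_meet_every_centi_interval (a b : ℝ) (ha : (81 / 64 : ℝ) ≤ a) (hb : b ≤ 2855 / 2048)
    (hab : (1 / 100 : ℝ) ≤ b - a) :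
    (∃ r : ℚ, r.den ≤ 64 ∧ a ≤ (r : ℝ) ∧ (r : ℝ) ≤ b) ∧
      (∃ v : ℚ, v ∈ kacFamily 24 8 ∧ a ≤ (v : ℝ) ∧ (v : ℝ) ≤ b) ∧
      (∃ v : ℚ, v ∈ kacxFamily ∧ a ≤ (v : ℝ) ∧ (v : ℝ) ≤ b) :=
  ⟨rat_meets_subinterval a b ha hb (by linarith), kac_meets_subinterval a b ha hb (by linarith),
    kacx_meets_subinterval a b ha hb (by linarith)⟩

end ColumnFaceL11
end Summit.CriticalPhenomena.Ising3D
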